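import Summits.ResolutionOfSingularities.ResolutionOfSingularities.Theorems.NearExitScheme
import Summits.ResolutionOfSingularities.ResolutionOfSingularities.Theorems.MaxContactCutPinchTower
import Summits.ResolutionOfSingularities.ResolutionOfSingularities.Theorems.SplitTowerChartW
import Summits.ResolutionOfSingularities.ResolutionOfSingularities.Theorems.SplitTowerCharts
import Literature.AlgebraicGeometry.Resolution.OrderSemicontinuityPointwise

/-!
# SplitTower (S-2/5, scheme level) — THE FRAME AT A SPLIT-CONE POINT and the chart dictionary for the controlled
transform

Node «SplitTower» of `decomp-res-lens-2` (g34), see `Theorems/MaxContactCutSplitTower.lean`.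

* `splitShape_of_isSplitConeAt` — the class predicate `IsSplitConeAt I n k η y` packaged as the ring-level normal form
  `SplitShape 𝓘_y 𝔓_{η,y} n k` of slice S-0 (`SplitTowerShape`), `n ≤ k`;
* `ChartFamily.stalkIdeal_controlledTransform` — at a chart point `q_j 𝔴` of a chart family of the blowing up of `C`
  centred at `s` (generators `c` of `C_s`), the stalk of the controlled transform `(𝓘𝒪 : (C𝒪)ⁿ)` is the ring-level
  `(𝓘_s S : (χ_𝔴 c_j)ⁿ)` for the dictionary map `χ_𝔴 ∘ chartBase = π^♯ ∘ generisation : 𝒪_{Y,s} → 𝒪_{Y₁, q_j 𝔴}`;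
* `stalkIdeal_le_pow_of_le_primeOfSpecializes_pow` — `𝓘_x ⊆ 𝔓_{ζ,x}ⁿ` at a specialisation `x` of `ζ` forces
  `𝓘_ζ ⊆ 𝔪_ζⁿ`; the origin point of the `W`-chart over the curve prime (`ChartFamily.originPt`).
[cite: CossartJannsenSaito2020, Ch. 2] [cite: StacksProject, Tag 0804] [cite: Hironaka1964]
-/

noncomputable section

open CategoryTheory AlgebraicGeometry TopologicalSpace Topology IsLocalRing
open Literature.AlgebraicGeometry.Resolution
open Summit.ResolutionOfSingularities.ResolutionOfSingularities.Theorems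
open Summit.ResolutionOfSingularities.ResolutionOfSingularities.Theorems.WeakOrderReduction
open Summit.ResolutionOfSingularities.ResolutionOfSingularities.Theorems.RelativeDeltaCut
open Summit.ResolutionOfSingularities.ResolutionOfSingularities.Theorems.SplitCut

namespace Summit.ResolutionOfSingularities.ResolutionOfSingularities.Theorems.SplitTower

/-! ## §F1  Generisation bookkeeping -/

section Generisation

variable {Y : Scheme.{0}}

/-- **`𝓘_x ⊆ 𝔓ⁿ` at a specialisation forces order `≥ n` at the generic point**: `𝓘_ζ = 𝓘_x 𝒪_ζ` and
`𝔓 𝒪_ζ ⊆ 𝔪_ζ`. [folklore] -/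
theorem stalkIdeal_le_pow_of_le_primeOfSpecializes_pow {ζ x : Y} (h : ζ ⤳ x) (I : Y.IdealSheafData) {n : ℕ}
    (hle : stalkIdeal I x ≤ primeOfSpecializes h ^ n) :
    stalkIdeal I ζ ≤ maximalIdeal (Y.presheaf.stalk ζ) ^ n := by
  rw [← stalkIdeal_map_stalkSpecializes I h]
  refine (Ideal.map_mono hle).trans ?_
  rw [Ideal.map_pow]
  exact Ideal.pow_right_mono Ideal.map_comap_le n

end Generisation

/-! ## §F2  The split shape at a split-cone point -/

section Shape

variable {Y : Scheme.{0}}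

/-- **THE SPLIT SHAPE AT A CLOSED POINT of the curve**: `IsSplitConeAt I n k η y` yields `n ≤ k` and the normal form
`SplitShape 𝓘_y 𝔓_{η,y} n k` (frame `c`, fourth parameter `v`, `(c, v)` a regular system of parameters since
`dim = 4`). [cite: CossartJannsenSaito2020, Ch. 2] -/
theorem splitShape_of_isSplitConeAt (hY : Scheme.IsRegular Y) (I : Y.IdealSheafData) {n k : ℕ} {η y : Y}
    (hpt : IsSplitConeAt I n k η y) :
    ∃ h : η ⤳ y, n ≤ k ∧ Nonempty (SplitShape (stalkIdeal I y) (curvePrime h) n k) := by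
  haveI := hY y
  obtain ⟨h, c, v, ϖ, ε, r, f, G, hP, hW', hd, hf, hshape⟩ := hpt
  obtain ⟨hfeq, hG0, hmid, hvtx, hε, htail, hnk, hndvd, hguard⟩ := hshape
  have hW : Ideal.span (Set.range (Fin.append c ![v])) = maximalIdeal _ := by
    rw [range_append_one]; exact hW'
  have hrsop : IsRsopPart (Fin.append c ![v]) :=
    isRsopPart_comp_of_rsop hd (Fin.append c ![v]) hW id Function.injective_id
  refine ⟨h, hnk, ⟨{
    c := c
    w := v
    ϖ := ϖ
    G := G
    ε := ε
    h := r
    rsop_cw := hrsop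
    span_c := hP
    span_cw := hW'
    ideal := by rw [hf, hfeq]
    G_zero := hG0
    mid := hmid
    vtx := hvtx
    unit := hε
    tail := htail
    ndvd := hndvd
    guard := hguard }⟩⟩

end Shape

/-! ## §F3  The chart dictionary for the controlled transform -/

section Dictionary

variable {Y' Y : Scheme.{0}} {π : Y' ⟶ Y} {s : Y} {m : ℕ} {c : Fin m → Y.presheaf.stalk s}

namespace ChartFamily

variable (F : ChartFamily π s c)

/-- **The dictionary map** `χ_𝔴 ∘ (𝒪_{Y,s} → B_j) = π^♯ ∘ generisation : 𝒪_{Y,s} → 𝒪_{Y', q_j 𝔴}`.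
[cite: StacksProject, Tag 0804] -/
theorem comp_eq (j : Fin m) (w : Spec (.of (chartRing c j))) :
    (F.χ j w).comp (chartBase c j) =
      (π.stalkMap (F.q j w)).hom.comp (Y.presheaf.stalkSpecializes (F.specializes j w)).hom :=
  RingHom.ext (F.χ_base j w)

set_option maxHeartbeats 400000 in -- WRITER NOTE (g16): pre-budgeted (elaboration exceeds 100k = half the tree default; ops-buildfix standing ask)
/-- `𝓘_s (χ_𝔴 ∘ chartBase) = 𝓘_{π(q_j 𝔴)} π^♯`: extending a stalk ideal along the dictionary map. [folklore] -/
theorem map_comp (I : Y.IdealSheafData) (j : Fin m) (w : Spec (.of (chartRing c j))) :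
    (stalkIdeal I s).map ((F.χ j w).comp (chartBase c j)) =
      (stalkIdeal I (π (F.q j w))).map (π.stalkMap (F.q j w)).hom := by
  rw [F.comp_eq, ← stalkIdeal_map_stalkSpecializes I (F.specializes j w)]
  exact (Ideal.map_map _ _).symm

set_option maxHeartbeats 400000 in -- WRITER NOTE (g16): pre-budgeted (elaboration exceeds 100k = half the tree default; ops-buildfix standing ask)
/-- `C_s (χ_𝔴 ∘ chartBase) = (χ_𝔴 (c_j))`: in the `j`-th chart the centre becomes principal.
[cite: StacksProject, Tag 0804] -/
theorem map_comp_centre {C : Y.IdealSheafData} (hc : Ideal.span (Set.range c) = stalkIdeal C s) (j : Fin m)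
    (w : Spec (.of (chartRing c j))) :
    (stalkIdeal C s).map ((F.χ j w).comp (chartBase c j)) =
      Ideal.span {((F.χ j w).comp (chartBase c j)) (c j)} := by
  have hu : ∀ l, F.χ j w (chartBase c j (c l)) = F.χ j w (chartBase c j (c j)) * F.χ j w (chartGen c j l) :=
    fun l => by rw [← map_mul, ← reesChartBase_apply_eq_mul_chartGen c j l]
  rw [← hc]
  exact Ideal.map_span_range_eq_span_singleton ((F.χ j w).comp (chartBase c j)) c j _ hu

/-- `C_{π(q_j 𝔴)} π^♯ = (χ_𝔴 (c_j))`. [cite: StacksProject, Tag 0804] -/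
theorem map_stalkMap_centre {C : Y.IdealSheafData} (hc : Ideal.span (Set.range c) = stalkIdeal C s)
    (j : Fin m) (w : Spec (.of (chartRing c j))) :
    (stalkIdeal C (π (F.q j w))).map (π.stalkMap (F.q j w)).hom =
      Ideal.span {((F.χ j w).comp (chartBase c j)) (c j)} := by
  rw [← F.map_comp C j w]
  exact F.map_comp_centre hc j w

end ChartFamily

/-- The stalk of the controlled transform `(𝓘𝒪 : (C𝒪)ⁿ)` at any point `x'`, in terms of `π^♯`. [cite: Hironaka1964] -/
theorem stalkIdeal_controlledTransform_eq [IsLocallyNoetherian Y'] (π : Y' ⟶ Y) (C I : Y.IdealSheafData)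
    (n : ℕ) (x' : Y') :
    stalkIdeal (controlledTransform π C I n) x' =
      Submodule.colon ((stalkIdeal I (π x')).map (π.stalkMap x').hom)
        (((stalkIdeal C (π x')).map (π.stalkMap x').hom ^ n : Ideal (Y'.presheaf.stalk x')) :
          Set (Y'.presheaf.stalk x')) := by
  rw [controlledTransform, stalkIdeal_colon, stalkIdeal_pow, stalkIdeal_comap_eq_map_stalkMap,
    stalkIdeal_comap_eq_map_stalkMap]

/-- **THE CONTROLLED TRANSFORM AT A CHART POINT**: for a chart family of `π : Y' → Y` centred at `s` whose frame `c`
generates `C_s`, `(𝓘𝒪 : (C𝒪)ⁿ)_{q_j 𝔴} = (𝓘_s S : (χ_𝔴 c_j)ⁿ)` with `S = 𝒪_{Y', q_j 𝔴}` an algebra over `𝒪_{Y,s}` through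
`χ_𝔴 ∘ chartBase`. [cite: Hironaka1964] -/
theorem ChartFamily.stalkIdeal_controlledTransform [IsLocallyNoetherian Y'] (C I : Y.IdealSheafData) (n : ℕ)
    (hc : Ideal.span (Set.range c) = stalkIdeal C s) (F : ChartFamily π s c) (j : Fin m)
    (w : Spec (.of (chartRing c j))) :
    stalkIdeal (controlledTransform π C I n) (F.q j w) =
      Submodule.colon ((stalkIdeal I s).map ((F.χ j w).comp (chartBase c j)))
        ((Ideal.span {((F.χ j w).comp (chartBase c j)) (c j)} ^ n : Ideal (Y'.presheaf.stalk (F.q j w))) :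
          Set (Y'.presheaf.stalk (F.q j w))) :=
  (stalkIdeal_controlledTransform_eq π C I n (F.q j w)).trans
    (congrArg₂ (fun A B => Submodule.colon A ((B ^ n : Ideal (Y'.presheaf.stalk (F.q j w))) :
      Set (Y'.presheaf.stalk (F.q j w)))) (F.map_comp I j w).symm (F.map_stalkMap_centre hc j w))

end Dictionary

/-! ## §F4  The origin of the `W`-chart over the curve prime -/

section Origin

variable {Y : Scheme.{0}} {J : Y.IdealSheafData} {n k : ℕ} {ζ x : Y} {hζx : ζ ⤳ x}

/-- **The origin `𝔴̃₀ = (e₀, e₁) + 𝔓 B₂` of the `W`-chart over the curve prime**, as a point of `Spec B₂`.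
DEFINITION (support). [this node] -/
noncomputable def originPt (D : SplitShape (stalkIdeal J x) (curvePrime hζx) n k) : Spec (.of (chartRing D.c 2)) :=
  ⟨originP D.c 2, by haveI := D.isPrime; exact originP_isPrime D.c 2 D.rsop.isQuasiRegular D.span_c⟩

/-- Unfolding `originPt`. [this node] -/
theorem originPt_asIdeal (D : SplitShape (stalkIdeal J x) (curvePrime hζx) n k) :
    (originPt D).asIdeal = originP D.c 2 := rfl

/-- **`𝔴̃₀` specialises to every prime containing `e₀, e₁` and lying over a prime containing `𝔓`.** [this node] -/
theorem originPt_specializes (D : SplitShape (stalkIdeal J x) (curvePrime hζx) n k)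
    {w : Spec (.of (chartRing D.c 2))} (hP : curvePrime hζx ≤ w.asIdeal.comap (chartBase D.c 2))
    (h0 : chartGen D.c 2 0 ∈ w.asIdeal) (h1 : chartGen D.c 2 1 ∈ w.asIdeal) : originPt D ⤳ w := by
  refine (PrimeSpectrum.le_iff_specializes (originPt D) w).mp ?_
  change originP D.c 2 ≤ w.asIdeal
  refine originP_le D.c 2 D.span_c (fun a ha => hP ha) fun l hl => ?_
  obtain rfl | rfl | rfl : l = 0 ∨ l = 1 ∨ l = 2 := by fin_cases l <;> simp
  exacts [h0, h1, absurd rfl hl]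

variable {C : Y.IdealSheafData}

/-- **`π (q₂ 𝔴̃₀) = ζ`**: the origin over the curve prime lies over the generic point of the curve. [this node] -/
theorem ChartFamily.base_originPt (D : SplitShape (stalkIdeal J x) (curvePrime hζx) n k)
    (F : ChartFamily (blowup.π C) x D.c) : blowup.π C (F.q 2 (originPt D)) = ζ :=
  (F.base_eq_iff 2 _ hζx).mpr (comap_originP D.c 2 D.rsop.isQuasiRegular D.span_c)

/-- **A closed origin over `x`**: a prime `𝔴₀ ⊇ (e₀, e₁)` of `B₂` over `𝔪_x`; `𝔴̃₀ ⤳ 𝔴₀` and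
`π (q₂ 𝔴₀) = x`. [this node] -/
theorem ChartFamily.exists_closedOrigin (D : SplitShape (stalkIdeal J x) (curvePrime hζx) n k)
    (F : ChartFamily (blowup.π C) x D.c) :
    ∃ w₀ : Spec (.of (chartRing D.c 2)), blowup.π C (F.q 2 w₀) = x ∧ originPt D ⤳ w₀ ∧
      chartGen D.c 2 0 ∈ w₀.asIdeal ∧ chartGen D.c 2 1 ∈ w₀.asIdeal := by
  have hcm : ∀ l, D.c l ∈ maximalIdeal _ := fun l =>
    D.le_maximalIdeal (D.span_c.le (Ideal.subset_span ⟨l, rfl⟩))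
  obtain ⟨w₀, hw₀, hgen, -⟩ := exists_origin D.c 2 D.rsop.isQuasiRegular hcm
  have h0 := hgen 0 (by decide)
  have h1 := hgen 1 (by decide)
  exact ⟨w₀, (F.base_eq_self_iff 2 w₀).mpr hw₀,
    originPt_specializes D (hw₀ ▸ D.le_maximalIdeal) h0 h1, h0, h1⟩

end Origin

end Summit.ResolutionOfSingularities.ResolutionOfSingularities.Theorems.SplitTower

end
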